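import Summits.NavierStokesRegularity.NavierStokesRegularity.Theses.ExtremiserTransience
import Summits.NavierStokesRegularity.NavierStokesRegularity.Theorems.ExtremiserTransienceNearExtremalTransienceExtremiserLiouvillePlateau
import Literature.Analysis.FluidPDE.SobolevWholeSpace
import Literature.Analysis.FluidPDE.VectorCalculusProofs
import Literature.Analysis.FluidPDE.KNSSThm52Integrand
import Literature.Analysis.FluidPDE.LocalBiotSavartCalculus
import Literature.Analysis.FluidPDE.BKMClassGradientContinuity
import Literature.Analysis.FluidPDE.NSRobustnessOfRegularity

noncomputable section
open Set Filter Topology MeasureTheory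
open scoped ENNReal ContDiff Laplacian RealInnerProductSpace
open InnerProductSpace
open Literature.Analysis.FluidPDE

namespace Summit.NavierStokesRegularity.NavierStokesRegularity.Cruxes.NearExtremalTransience.StaticSlack

local notation "E3" => EuclideanSpace ℝ (Fin 3)

/-- P2-L1 (first prover target for S1, critic V62): far-field velocity-gradient (hence strain) bound — an admissible `L²` field whose
vorticity vanishes on `ball x₀ (D + r)` has `|∇v| ≤ C·D^{-3/2}·‖ω‖₂` on `ball x₀ r` (Biot–Savart: `∇v = ∫ ∇K(x−y) ω(y) dy` over
`|x−y| ≥ D`, `|∇K(z)| ≤ c|z|^{-3}`, Cauchy–Schwarz). Size M. -/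
def FarFieldStrainBound : Prop :=
  ∃ C : ℝ, 0 < C ∧ ∀ (v : E3 → E3) (x₀ : E3) (r D : ℝ), 0 < r → 0 < D →
    ContDiff ℝ (⊤ : ℕ∞) v → VectorCalculus.IsDivFree v →
    (∫⁻ x, ‖v x‖ₑ ^ 2 < ⊤) → (∫⁻ x, ‖iteratedFDeriv ℝ 1 v x‖ₑ ^ 2 < ⊤) →
    (∀ y ∈ Metric.ball x₀ (D + r), curl v y = 0) →
    ∀ x ∈ Metric.ball x₀ r, ‖fderiv ℝ v x‖ ≤ C * D ^ (-(3:ℝ) / 2) * Real.sqrt (∫ y, ‖curl v y‖ ^ 2)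

/-- P2-L2: far-field velocity bound `|v| ≤ C·D^{-1/2}·‖ω‖₂` on `ball x₀ r` under the same hypotheses (`|K(z)| ≤ c|z|^{-2}`). Size M. -/
def FarFieldVelocityBound : Prop :=
  ∃ C : ℝ, 0 < C ∧ ∀ (v : E3 → E3) (x₀ : E3) (r D : ℝ), 0 < r → 0 < D →
    ContDiff ℝ (⊤ : ℕ∞) v → VectorCalculus.IsDivFree v →
    (∫⁻ x, ‖v x‖ₑ ^ 2 < ⊤) → (∫⁻ x, ‖iteratedFDeriv ℝ 1 v x‖ₑ ^ 2 < ⊤) →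
    (∀ y ∈ Metric.ball x₀ (D + r), curl v y = 0) →
    ∀ x ∈ Metric.ball x₀ r, ‖v x‖ ≤ C * D ^ (-(1:ℝ) / 2) * Real.sqrt (∫ y, ‖curl v y‖ ^ 2)

/-- P2-L3 (the elementary mediant step of the dichotomy): for nonnegative data,
`(J₁ + J₂)/(√(Z₁+Z₂) √(P₁+P₂)) ≤ max (J₁/(√Z₁ √P₁)) (J₂/(√Z₂ √P₂))`. Proved here (it is bookkeeping, recorded so nobody re-derives it). -/
theorem mediant_efficiency (J₁ J₂ Z₁ Z₂ P₁ P₂ : ℝ) (hJ₁ : 0 ≤ J₁) (hJ₂ : 0 ≤ J₂) (hZ₁ : 0 < Z₁) (hZ₂ : 0 < Z₂)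
    (hP₁ : 0 < P₁) (hP₂ : 0 < P₂) :
    (J₁ + J₂) / (Real.sqrt (Z₁ + Z₂) * Real.sqrt (P₁ + P₂))
      ≤ max (J₁ / (Real.sqrt Z₁ * Real.sqrt P₁)) (J₂ / (Real.sqrt Z₂ * Real.sqrt P₂)) := by
  set m := max (J₁ / (Real.sqrt Z₁ * Real.sqrt P₁)) (J₂ / (Real.sqrt Z₂ * Real.sqrt P₂)) with hm
  have h1 : 0 < Real.sqrt Z₁ * Real.sqrt P₁ := by positivity
  have h2 : 0 < Real.sqrt Z₂ * Real.sqrt P₂ := by positivity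
  have hJ₁' : J₁ ≤ m * (Real.sqrt Z₁ * Real.sqrt P₁) := by
    have : J₁ / (Real.sqrt Z₁ * Real.sqrt P₁) ≤ m := le_max_left _ _
    rwa [div_le_iff₀ h1] at this
  have hJ₂' : J₂ ≤ m * (Real.sqrt Z₂ * Real.sqrt P₂) := by
    have : J₂ / (Real.sqrt Z₂ * Real.sqrt P₂) ≤ m := le_max_right _ _
    rwa [div_le_iff₀ h2] at this
  have hm0 : 0 ≤ m := le_trans (div_nonneg hJ₁ h1.le) (le_max_left _ _)
  -- Cauchy–Schwarz: √Z₁√P₁ + √Z₂√P₂ ≤ √(Z₁+Z₂) √(P₁+P₂)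
  have hCS : Real.sqrt Z₁ * Real.sqrt P₁ + Real.sqrt Z₂ * Real.sqrt P₂
      ≤ Real.sqrt (Z₁ + Z₂) * Real.sqrt (P₁ + P₂) := by
    rw [← Real.sqrt_mul hZ₁.le, ← Real.sqrt_mul hZ₂.le, ← Real.sqrt_mul (by positivity)]
    have ha : 0 ≤ Real.sqrt (Z₁ * P₁) + Real.sqrt (Z₂ * P₂) := by positivity
    rw [show Real.sqrt (Z₁ * P₁) + Real.sqrt (Z₂ * P₂)
        = Real.sqrt ((Real.sqrt (Z₁ * P₁) + Real.sqrt (Z₂ * P₂)) ^ 2) from (Real.sqrt_sq ha).symm]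
    apply Real.sqrt_le_sqrt
    have e1 : Real.sqrt (Z₁ * P₁) ^ 2 = Z₁ * P₁ := Real.sq_sqrt (by positivity)
    have e2 : Real.sqrt (Z₂ * P₂) ^ 2 = Z₂ * P₂ := Real.sq_sqrt (by positivity)
    have e3 : Real.sqrt (Z₁ * P₁) * Real.sqrt (Z₂ * P₂) = Real.sqrt (Z₁ * P₂) * Real.sqrt (Z₂ * P₁) := by
      rw [← Real.sqrt_mul (by positivity), ← Real.sqrt_mul (by positivity)]; ring_nf
    have e4 : 2 * (Real.sqrt (Z₁ * P₂) * Real.sqrt (Z₂ * P₁)) ≤ Z₁ * P₂ + Z₂ * P₁ := by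
      have := two_mul_le_add_sq (Real.sqrt (Z₁ * P₂)) (Real.sqrt (Z₂ * P₁))
      rw [Real.sq_sqrt (by positivity), Real.sq_sqrt (by positivity)] at this
      linarith
    nlinarith [e1, e2, e3, e4]
  have hpos : 0 < Real.sqrt (Z₁ + Z₂) * Real.sqrt (P₁ + P₂) := by positivity
  rw [div_le_iff₀ hpos]
  calc J₁ + J₂ ≤ m * (Real.sqrt Z₁ * Real.sqrt P₁) + m * (Real.sqrt Z₂ * Real.sqrt P₂) := add_le_add hJ₁' hJ₂'
    _ = m * (Real.sqrt Z₁ * Real.sqrt P₁ + Real.sqrt Z₂ * Real.sqrt P₂) := by ring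
    _ ≤ m * (Real.sqrt (Z₁ + Z₂) * Real.sqrt (P₁ + P₂)) := mul_le_mul_of_nonneg_left hCS hm0

/-- P2-L4 (S1 proof plan, step 3 — the constant-speed exit is closed UNIFORMLY): Chebyshev–Sobolev volume bound for the super-level sets of
the speed of an `L²` field with square-integrable gradient on `ℝ³`: `vol{s ≤ |v|} ≤ s^{-6} · (K‖∇v‖₂)^6` with `K` the tree's GNS constant
(`SNormLESNormFDerivOfEqConst`, `p = 2`, `p' = 6`).  Along a sequence with `‖∇v_n‖₂² = Z_n ≤ N` this bound is uniform, passes to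
`C^0_loc` limits, and forbids a limit of constant positive speed.  PROVED (Mathlib Chebyshev–Markov + tree whole-space GNS). -/
theorem volume_speed_superlevel_le (v : E3 → E3) (hv : ContDiff ℝ 1 v) (hL2 : eLpNorm v 2 volume < ⊤) {s : ℝ} (hs : 0 < s) :
    volume {x | s ≤ ‖v x‖} ≤ (ENNReal.ofReal s)⁻¹ ^ (6:ℝ) *
      ((SNormLESNormFDerivOfEqConst E3 (volume : Measure E3) 2 : ℝ≥0∞) * eLpNorm (fderiv ℝ v) 2 volume) ^ (6:ℝ) := by
  have hn : 0 < Module.finrank ℝ E3 := by simp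
  have hGNS := eLpNorm_le_eLpNorm_fderiv_of_eq_of_eLpNorm_lt_top (F := E3) (volume : Measure E3) hv
    (p := 2) (p' := 6) (by norm_num) hn (by norm_num [finrank_euclideanSpace]) hL2
  have hset : {x | s ≤ ‖v x‖} = {x | ENNReal.ofReal s ≤ ‖v x‖ₑ} := by
    ext x
    simp only [Set.mem_setOf_eq]
    rw [← ofReal_norm_eq_enorm, ENNReal.ofReal_le_ofReal_iff (norm_nonneg _)]
  have hε : ENNReal.ofReal s ≠ 0 := by simpa using hs
  have hcheb := meas_ge_le_mul_pow_eLpNorm_enorm (μ := (volume : Measure E3)) (p := (6 : ℝ≥0∞)) (by norm_num) (by norm_num)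
    (hv.continuous.aestronglyMeasurable) hε (fun h => absurd h ENNReal.ofReal_ne_top)
  rw [hset]
  refine hcheb.trans ?_
  have h6 : (6 : ℝ≥0∞).toReal = 6 := by norm_num
  rw [h6]
  gcongr
  exact_mod_cast hGNS

/-- Helper: a pointwise bound `‖f x‖ ≤ C‖g x‖` with `0 ≤ C` transfers the finiteness of `∫⁻ ‖g‖ₑ²` to `∫⁻ ‖f‖ₑ²`. -/
theorem lintegral_enorm_sq_lt_top_of_norm_le {α F G : Type*} [MeasurableSpace α] {μ : Measure α}
    [NormedAddCommGroup F] [NormedAddCommGroup G] {f : α → F} {g : α → G} {C : ℝ} (hC : 0 ≤ C)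
    (hfg : ∀ x, ‖f x‖ ≤ C * ‖g x‖) (hg : ∫⁻ x, ‖g x‖ₑ ^ 2 ∂μ < ⊤) : ∫⁻ x, ‖f x‖ₑ ^ 2 ∂μ < ⊤ := by
  have hpt : ∀ x, ‖f x‖ₑ ^ 2 ≤ ENNReal.ofReal C ^ 2 * ‖g x‖ₑ ^ 2 := fun x => by
    rw [← mul_pow, ← ofReal_norm_eq_enorm, ← ofReal_norm_eq_enorm, ← ENNReal.ofReal_mul hC]
    exact pow_le_pow_left' (ENNReal.ofReal_le_ofReal (hfg x)) 2
  calc ∫⁻ x, ‖f x‖ₑ ^ 2 ∂μ ≤ ∫⁻ x, ENNReal.ofReal C ^ 2 * ‖g x‖ₑ ^ 2 ∂μ := lintegral_mono hpt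
    _ = ENNReal.ofReal C ^ 2 * ∫⁻ x, ‖g x‖ₑ ^ 2 ∂μ := lintegral_const_mul' _ _ (by simp)
    _ < ⊤ := ENNReal.mul_lt_top (by simp) hg

/-- P2-L5 (S1 proof plan, step 4 — the QUANTA FLOOR; Agmon): every smooth divergence-free field with `v, Dv, D²v, D³v ∈ L²` satisfies,
at EVERY point, `‖v x‖⁴ ≤ A⁴ · Z(v) · P(v)` with `A = agmonConst` (tree, proved), `Z = ∫|curl v|²`, `P = ∫|∇ curl v|²_F` — i.e. the quanta
number `𝒩(v) = √Z√P / sup|v|²` is bounded BELOW by `agmonConst⁻²` universally.  Consequences: in `UncrowdedLockedTimes`/`NoEfficientCrowds`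
only `N ≥ agmonConst⁻²` is non-vacuous; in S1's compactness step each extracted profile of sup-speed `≥ ½M` carries `√Z√P ≥ M²/(4A²)`, so at
most `4A²N` profiles are extracted.  PROVED from the tree's Agmon inequality `norm_le_agmonConst_mul_rpow`, the identities
`∫|∇v|²_F = ∫|curl v|²` (`integral_frobeniusNormSq_fderiv_eq_integral_norm_curl_sq`, for `v` and for `curl v`) and `curl curl v = −Δv`. -/
theorem quanta_floor (v : E3 → E3) (hv : ContDiff ℝ (⊤ : ℕ∞) v) (hdiv : VectorCalculus.IsDivFree v)
    (h0 : ∫⁻ x, ‖iteratedFDeriv ℝ 0 v x‖ₑ ^ 2 < ⊤) (h1 : ∫⁻ x, ‖iteratedFDeriv ℝ 1 v x‖ₑ ^ 2 < ⊤)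
    (h2 : ∫⁻ x, ‖iteratedFDeriv ℝ 2 v x‖ₑ ^ 2 < ⊤) (h3 : ∫⁻ x, ‖iteratedFDeriv ℝ 3 v x‖ₑ ^ 2 < ⊤) (x : E3) :
    ‖v x‖ ^ 4 ≤ agmonConst ^ 4 * (∫ y, ‖curl v y‖ ^ 2) * (∫ y, frobeniusNormSq (fderiv ℝ (curl v) y)) := by
  have hv2 : ContDiff ℝ 2 v := hv.of_le (by norm_cast)
  have hc : ContDiff ℝ (⊤ : ℕ∞) (curl v) := contDiff_curl hv
  have hc2 : ContDiff ℝ 2 (curl v) := hc.of_le (by norm_cast)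
  -- `L²` data for `curl v` from those of `v`
  have hK : 0 ≤ ‖(curlCLM : (E3 →L[ℝ] E3) →L[ℝ] E3)‖ := ContinuousLinearMap.opNorm_nonneg _
  have hc0 : ∫⁻ y, ‖curl v y‖ₑ ^ 2 < ⊤ := by
    have h1' : ∫⁻ y, ‖iteratedFDeriv ℝ 1 v y‖ₑ ^ 2 < ⊤ := h1
    refine lintegral_enorm_sq_lt_top_of_norm_le hK (fun y => ?_) h1'
    have := norm_iteratedFDeriv_curl_le (n := 0) (hv.of_le (by norm_cast)) y
    simpa [norm_iteratedFDeriv_zero] using this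
  have he0 : ∀ (f : E3 → E3) (y : E3), ‖iteratedFDeriv ℝ 0 f y‖ₑ = ‖f y‖ₑ := fun f y => by
    rw [← ofReal_norm_eq_enorm, norm_iteratedFDeriv_zero, ofReal_norm_eq_enorm]
  have hc0' : ∫⁻ y, ‖iteratedFDeriv ℝ 0 (curl v) y‖ₑ ^ 2 < ⊤ := by simp_rw [he0]; exact hc0
  have hc1 : ∫⁻ y, ‖iteratedFDeriv ℝ 1 (curl v) y‖ₑ ^ 2 < ⊤ :=
    lintegral_enorm_sq_lt_top_of_norm_le hK (fun y => norm_iteratedFDeriv_curl_le (n := 1) (hv.of_le (by norm_cast)) y) h2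
  have hc2' : ∫⁻ y, ‖iteratedFDeriv ℝ 2 (curl v) y‖ₑ ^ 2 < ⊤ :=
    lintegral_enorm_sq_lt_top_of_norm_le hK (fun y => norm_iteratedFDeriv_curl_le (n := 2) (hv.of_le (by norm_cast)) y) h3
  have hv0 : ∫⁻ y, ‖v y‖ₑ ^ 2 < ⊤ := by have h := h0; simp_rw [he0] at h; exact h
  -- the two identities
  have hZ : ∫ y, frobeniusNormSq (fderiv ℝ v y) = ∫ y, ‖curl v y‖ ^ 2 :=
    integral_frobeniusNormSq_fderiv_eq_integral_norm_curl_sq hv2 hdiv hv0 h1 h2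
  have hdivc : VectorCalculus.IsDivFree (curl v) := fun y => divergence_curl_eq_zero_holds v hv2 y
  have hP : ∫ y, ‖(Δ v) y‖ ^ 2 = ∫ y, frobeniusNormSq (fderiv ℝ (curl v) y) := by
    rw [integral_frobeniusNormSq_fderiv_eq_integral_norm_curl_sq hc2 hdivc hc0 hc1 hc2']
    refine integral_congr_ae (Eventually.of_forall fun y => ?_)
    simp only [curl_curl_eq_neg_laplacian hv2 hdiv y, norm_neg]
  -- Agmon
  have hA := norm_le_agmonConst_mul_rpow hv h0 h1 h2 h3 x
  rw [hZ, hP] at hA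
  have hA0 : 0 ≤ agmonConst := agmonConst_nonneg
  have hZP : 0 ≤ (∫ y, ‖curl v y‖ ^ 2) * ∫ y, frobeniusNormSq (fderiv ℝ (curl v) y) :=
    mul_nonneg (integral_nonneg fun _ => sq_nonneg _) (integral_nonneg fun _ => frobeniusNormSq_nonneg _)
  have h4 : ‖v x‖ ^ 4 ≤ (agmonConst * ((∫ y, ‖curl v y‖ ^ 2) * ∫ y, frobeniusNormSq (fderiv ℝ (curl v) y)) ^ (1 / 4 : ℝ)) ^ 4 :=
    pow_le_pow_left₀ (norm_nonneg _) hA 4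
  have hroot : (((∫ y, ‖curl v y‖ ^ 2) * ∫ y, frobeniusNormSq (fderiv ℝ (curl v) y)) ^ (1 / 4 : ℝ)) ^ 4 =
      (∫ y, ‖curl v y‖ ^ 2) * ∫ y, frobeniusNormSq (fderiv ℝ (curl v) y) := by
    rw [← Real.rpow_natCast _ 4, ← Real.rpow_mul hZP]; norm_num
  calc ‖v x‖ ^ 4 ≤ _ := h4
    _ = agmonConst ^ 4 * (((∫ y, ‖curl v y‖ ^ 2) * ∫ y, frobeniusNormSq (fderiv ℝ (curl v) y)) ^ (1 / 4 : ℝ)) ^ 4 := by ring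
    _ = agmonConst ^ 4 * (∫ y, ‖curl v y‖ ^ 2) * (∫ y, frobeniusNormSq (fderiv ℝ (curl v) y)) := by
      rw [hroot]; ring

/-- P2-L6 (S1 proof plan, step 7 — NO «PLATEAU AT INFINITY» for finite-superlevel-volume Lipschitz fields; serves S1 and the K1b far-field-gap
residue): if `w` is `K`-Lipschitz and the super-level set `{s ≤ ‖w‖}` has finite volume for some `0 < s < M'`, then `{M' < ‖w‖}` is BOUNDED —
so the supremum of `‖w‖`, if `> M'`, is attained (continuity on a compact closure), i.e. the contact set is nonempty.  Proof: otherwise pick points of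
`{M' < ‖w‖}` marching to infinity with gaps `> 2r`, `r = (M' − s)/K`; the balls `B(xₙ, r)` are disjoint and lie in `{s ≤ ‖w‖}`, whose volume is
then infinite.  PROVED. -/
theorem superlevel_isBounded_of_lipschitz {w : E3 → E3} {K s M' : ℝ} (hK : 0 < K) (hs : 0 < s) (hsM : s < M')
    (hlip : ∀ x y, ‖w x - w y‖ ≤ K * ‖x - y‖) (hvol : volume {x | s ≤ ‖w x‖} < ⊤) :
    Bornology.IsBounded {x : E3 | M' < ‖w x‖} := by
  by_contra hnb
  set S : Set E3 := {x | M' < ‖w x‖} with hS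
  set r : ℝ := (M' - s) / K with hr
  have hr0 : 0 < r := div_pos (by linarith) hK
  -- unboundedness: points of `S` of arbitrarily large norm
  have hfar : ∀ R : ℝ, ∃ x ∈ S, R < ‖x‖ := by
    intro R
    by_contra hR
    push_neg at hR
    exact hnb ((Metric.isBounded_closedBall (x := (0 : E3)) (r := R)).subset fun x hx => by
      simpa [Metric.mem_closedBall, dist_zero_right] using hR x hx)
  choose g hgS hgR using hfar
  -- the marching sequence
  let x : ℕ → E3 := fun n => Nat.rec (g 0) (fun _ y => g (‖y‖ + 2 * r)) n
  have hxS : ∀ n, x n ∈ S := by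
    intro n; cases n with
    | zero => exact hgS 0
    | succ n => exact hgS _
  have hxstep : ∀ n, ‖x n‖ + 2 * r < ‖x (n + 1)‖ := fun n => hgR _
  have hxmono : ∀ m n, m < n → ‖x m‖ + 2 * r < ‖x n‖ := by
    intro m n hmn
    induction n with
    | zero => exact absurd hmn (Nat.not_lt_zero _)
    | succ n ih =>
      rcases Nat.lt_succ_iff_lt_or_eq.mp hmn with h | h
      · have := ih h; have := hxstep n; linarith [hr0]
      · subst h; exact hxstep m
  -- the balls `B(x n, r)` are pairwise disjoint
  have hdisj : Pairwise (Function.onFun Disjoint fun n => Metric.ball (x n) r) := by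
    intro m n hmn
    have hd : 2 * r < dist (x m) (x n) := by
      rcases lt_or_gt_of_ne hmn with h | h
      · have := hxmono m n h
        rw [dist_eq_norm]; linarith [norm_sub_norm_le (x n) (x m), norm_sub_rev (x m) (x n)]
      · have := hxmono n m h
        rw [dist_eq_norm]; linarith [norm_sub_norm_le (x m) (x n)]
    exact Metric.ball_disjoint_ball (by linarith)
  -- each ball lies in the super-level set `{s ≤ ‖w‖}`
  have hsub : (⋃ n, Metric.ball (x n) r) ⊆ {y | s ≤ ‖w y‖} := by
    intro y hy
    obtain ⟨n, hn⟩ := Set.mem_iUnion.mp hy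
    have hyn : ‖y - x n‖ < r := by simpa [Metric.mem_ball, dist_eq_norm] using hn
    have h1 : ‖w (x n)‖ - ‖w y‖ ≤ K * ‖x n - y‖ := (norm_sub_norm_le _ _).trans (hlip _ _)
    have h2 : K * ‖x n - y‖ ≤ K * r := by
      rw [norm_sub_rev]; exact mul_le_mul_of_nonneg_left hyn.le hK.le
    have h3 : K * r = M' - s := by rw [hr]; field_simp
    have h4 : M' < ‖w (x n)‖ := hxS n
    show s ≤ ‖w y‖
    linarith
  -- volume of the union is infinite
  have hball : ∀ n, volume (Metric.ball (x n) r) = volume (Metric.ball (0 : E3) r) := fun n =>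
    Measure.addHaar_ball_center volume (x n) r
  have hpos : volume (Metric.ball (0 : E3) r) ≠ 0 := (Metric.measure_ball_pos volume _ hr0).ne'
  have hU : volume (⋃ n, Metric.ball (x n) r) = ⊤ := by
    rw [measure_iUnion hdisj fun n => measurableSet_ball]
    simp_rw [hball]
    exact ENNReal.tsum_const_eq_top_of_ne_zero hpos
  exact absurd ((measure_mono hsub).trans_lt hvol) (by rw [hU]; exact lt_irrefl _)

/-- P2-L7 (S1 proof plan, step 6 ASSEMBLED — the profile contradiction): an ANALYTIC extended-class field (`|v| ≤ M`, `|∇v| ≤ B`, `Dv, D²v ∈ L²`)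
that is EXTREMAL for the sharp constant (the `hatt` of the tree's `ExtremiserLiouville.norm_eq_of_analytic_extremal`, i.e. `|J| = κ⋆·M·√Z·√P`
with `κ⋆` the `L²`-class constant) cannot have a super-level set `{s ≤ ‖v‖}`, `0 < s < M`, of finite volume.  This is exactly the situation
of S1's limiting profile (finite super-level volume from `volume_speed_superlevel_le`, uniformly along the sequence).  Proof: the tree theorem gives
`‖v‖ ≡ M`; then `{(s+M)/2 < ‖v‖} = ℝ³` would be bounded by `superlevel_isBounded_of_lipschitz`.  PROVED (K1b contact case + P2-L6). -/
theorem no_extremal_profile_of_finite_superlevel_volume {v : E3 → E3}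
    (hv : ContDiff ℝ (⊤ : ℕ∞) v) (han : AnalyticOnNhd ℝ v univ) (hdiv : VectorCalculus.IsDivFree v) {M B s : ℝ}
    (hM : ∀ x, ‖v x‖ ≤ M) (hB : ∀ x, ‖fderiv ℝ v x‖ ≤ B)
    (h1 : ∫⁻ x, ‖iteratedFDeriv ℝ 1 v x‖ₑ ^ 2 < ⊤) (h2 : ∫⁻ x, ‖iteratedFDeriv ℝ 2 v x‖ₑ ^ 2 < ⊤)
    (hpos : 0 < M * Real.sqrt (∫ x, ‖curl v x‖ ^ 2) * Real.sqrt (∫ x, frobeniusNormSq (fderiv ℝ (curl v) x)))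
    (hatt : |∫ x, ⟪curl v x, fderiv ℝ v x (curl v x)⟫_ℝ| = (sInf {κ : ℝ | (∀ (v : EuclideanSpace ℝ (Fin 3) → EuclideanSpace ℝ (Fin 3)) (M B : ℝ), ContDiff ℝ (⊤ : ℕ∞) v → Literature.Analysis.FluidPDE.VectorCalculus.IsDivFree v → (∀ x, ‖v x‖ ≤ M) → (∀ x, ‖fderiv ℝ v x‖ ≤ B) → (∫⁻ x, ‖iteratedFDeriv ℝ 0 v x‖ₑ ^ 2 < ⊤) → (∫⁻ x, ‖iteratedFDeriv ℝ 1 v x‖ₑ ^ 2 < ⊤) → (∫⁻ x, ‖iteratedFDeriv ℝ 2 v x‖ₑ ^ 2 < ⊤) → |∫ x, ⟪Literature.Analysis.FluidPDE.curl v x, fderiv ℝ v x (Literature.Analysis.FluidPDE.curl v x)⟫_ℝ| ≤ κ * M * Real.sqrt (∫ x, ‖Literature.Analysis.FluidPDE.curl v x‖ ^ 2) * Real.sqrt (∫ x, Literature.Analysis.FluidPDE.frobeniusNormSq (fderiv ℝ (Literature.Analysis.FluidPDE.curl v) x)))}) * M * Real.sqrt (∫ x, ‖curl v x‖ ^ 2)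 * Real.sqrt (∫ x, frobeniusNormSq (fderiv ℝ (curl v) x)))
    (hs : 0 < s) (hsM : s < M) (hvol : volume {x | s ≤ ‖v x‖} < ⊤) : False := by
  have hcs : ∀ x, ‖v x‖ = M :=
    Summit.NavierStokesRegularity.NavierStokesRegularity.Theorems.ExtremiserLiouville.norm_eq_of_analytic_extremal hv han hdiv hM hB h1 h2 hpos hatt
  -- Lipschitz bound from `|∇v| ≤ B ≤ max B 1`
  have hK : 0 < max B 1 := lt_of_lt_of_le one_pos (le_max_right _ _)
  have hdiff : ∀ x ∈ (univ : Set E3), DifferentiableAt ℝ v x := fun x _ =>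
    (hv.differentiable (by norm_cast)).differentiableAt
  have hlip : ∀ x y, ‖v x - v y‖ ≤ max B 1 * ‖x - y‖ := fun x y =>
    (convex_univ.norm_image_sub_le_of_norm_fderiv_le (𝕜 := ℝ) hdiff (fun z _ => (hB z).trans (le_max_left _ _)) (mem_univ y) (mem_univ x))
  have hsM' : s < (s + M) / 2 := by linarith
  have hbdd := superlevel_isBounded_of_lipschitz (w := v) (M' := (s + M) / 2) hK hs hsM' hlip hvol
  have huniv : {x : E3 | (s + M) / 2 < ‖v x‖} = univ := by
    ext x; simp only [mem_setOf_eq, mem_univ, iff_true, hcs x]; linarith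
  rw [huniv] at hbdd
  exact NormedSpace.unbounded_univ ℝ E3 hbdd

end Summit.NavierStokesRegularity.NavierStokesRegularity.Cruxes.NearExtremalTransience.StaticSlack
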